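import Summits.RiemannHypothesis.RiemannHypothesis.Theorems.SignConeCondRungSOSFiftyFiveChunksA
import Summits.RiemannHypothesis.RiemannHypothesis.Theorems.SignConeCondRungSOSFiftyFiveChunksB
import Summits.RiemannHypothesis.RiemannHypothesis.Theorems.SignConeCondRungPlattTrudgian
import Summits.RiemannHypothesis.RiemannHypothesis.Theorems.SignConeUnitSlackReduction
import Literature.NumberTheory.LFunctions.RHWave0NumericalRHProofs
import Mathlib.Analysis.Complex.ExponentialBounds

/-!
# Route SignCone — conditional rungs, X: the Platt–Trudgian instance at cutoff `2` (with the SOS correction)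

Items stmt-RiemannHypothesis-16301/16302. As `SignConeCondRungPlattTrudgian` (cutoff `19/10`, no SOS), but with `N′ = 55` honest
nodes (`e^{2·401/200} < 56`) and the kernel-checked Dirichlet-SOS correction `crSOS55` (`SignConeCondRungSOSFiftyFive*`): the comb
bound drops from the trivial `Σ_{n≤55} 2Λ(n)/√n = 24.38` to `M = sosBound + errTotal ≤ 18.17222`, which fits the Platt–Trudgian
budget, so `platt_trudgian_numerical_rh` gives Weil's functional with unit slack on `[-2, 2]` (`unitSlackWeil_two_of_plattTrudgian`)
and the route items for all cutoffs `a ≤ 2` (`signConeOscillatory_upTo_two_of_plattTrudgian`, `signConeInequality_upTo_two_of_plattTrudgian`).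
CONDITIONAL on the named fact `platt_trudgian_numerical_rh`. Parameters: `b′ = 401/200`, kernel `⟨401/100, 2, []⟩` (`C_E ≤ 56`),
`m = 4`, `h = 3·10⁻¹²`, `Y₂ = 10¹⁰`, `κ = 1/2`, `B ≈ 246.5`.
-/

noncomputable section

-- `Summit.RiemannHypothesis.RiemannHypothesis.…` repeats a namespace component by design (D-0017 layout).
set_option linter.dupNamespace false

open scoped BigOperators ComplexConjugate Real Topology ArithmeticFunction.vonMangoldt
open Complex MeasureTheory Set Filter

namespace Summit.RiemannHypothesis.RiemannHypothesis.Theorems.SignCone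

open Literature.NumberTheory.LFunctions Literature.Analysis.SpecialFunctions
open Literature.NumberTheory.LFunctions.ZetaZeroTails (tailInvImSq tailInvImSq_le tailInvImSq_nonneg Gtail_le)
open Literature.NumberTheory.LFunctions.SchoenfeldBound (Gtail)
open Literature.Analysis.ValidatedNumerics.Numerics

/-! ### Data and numerical lemmas -/

/-- The plateau kernel `χ ≡ 1` on `[0, 401/100]`, linear to `0` on `[401/100, 601/100]`. [folklore] -/
def crKernel2 : PWKernel := ⟨401 / 100, 2, []⟩

/-- `e^{2} ≤ 7.39`. [folklore] -/
theorem exp_two_le : Real.exp 2 ≤ 739 / 100 := by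
  have := exp_le_of_expFI (q := 2) (r := 739 / 100) (by decide +kernel)
  push_cast at this; exact this

/-- `e^{601/200} ≤ 20.2`. [folklore] -/
theorem exp_3005_le : Real.exp (601 / 200) ≤ 202 / 10 := by
  have := exp_le_of_expFI (q := 601 / 200) (r := 202 / 10) (by decide +kernel)
  push_cast at this; exact this

/-- `e^{401/200} ≤ 7.43`. [folklore] -/
theorem exp_2005_le : Real.exp (401 / 200) ≤ 743 / 100 := by
  have := exp_le_of_expFI (q := 401 / 200) (r := 743 / 100) (by decide +kernel)
  push_cast at this; exact this

/-- `e^{401/100} < 55.5`. [folklore] -/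
theorem exp_401_lt : Real.exp (401 / 100) < 111 / 2 := by
  have := exp_le_of_expFI (q := 401 / 100) (r := 5549 / 100) (by decide +kernel)
  push_cast at this; linarith

/-- `C_E ≤ 56` for the plateau kernel. [folklore] -/
theorem decayConst_crKernel2_le : crKernel2.decayConst ≤ 56 := by
  unfold PWKernel.decayConst PWKernel.K PWKernel.knot
  simp only [crKernel2, List.length_nil, zero_add, Finset.Ico_self, Finset.sum_empty, add_zero]
  push_cast
  have h1 := exp_3005_le
  have h2 := exp_2005_le
  norm_num at h1 h2 ⊢
  linarith

/-- **The certified SOS comb bound**: `sosBound + errTotal ≤ 18.17222`. [folklore] -/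
theorem sos55_bound_le :
    (crSOS55.sosBound (List.range' 2 54) coef55.qAt : ℝ) + coef55.errTotal ≤ (4543053/250000) := by
  have hs : crSOS55.sosBound (List.range' 2 54) coef55.qAt ≤ (9086101/500000) := by
    rw [SOSData.sosBound_eq_sumR, show crSOS55.Np = 60 + 22 from rfl, sumR_add', show (60 : ℕ) = 40 + 20 from rfl,
      sumR_add', show (40 : ℕ) = 20 + 20 from rfl, sumR_add', show (20 : ℕ) = 12 + 8 from rfl, sumR_add',
      show (12 : ℕ) = 5 + 7 from rfl, sumR_add', show (5 : ℕ) = 1 + 4 from rfl, sumR_add', show (1 : ℕ) = 0 + 1 from rfl,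
      sumR_add', sumR_zero, zero_add]
    have h0 := crSOS55_chunk0; have h1 := crSOS55_chunk1; have h2 := crSOS55_chunk2; have h3 := crSOS55_chunk3
    have h4 := crSOS55_chunk4; have h5 := crSOS55_chunk5; have h6 := crSOS55_chunk6
    norm_num at h0 h1 h2 h3 h4 h5 h6 ⊢
    linarith
  have he := coef55_errTotal_le
  have hs' : ((crSOS55.sosBound (List.range' 2 54) coef55.qAt : ℚ) : ℝ) ≤ (((9086101/500000) : ℚ) : ℝ) := Rat.cast_le.2 hs
  have he' : ((coef55.errTotal : ℚ) : ℝ) ≤ ((1 / 100000 : ℚ) : ℝ) := Rat.cast_le.2 he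
  push_cast at hs' he'
  norm_num at hs' he' ⊢
  linarith

/-! ### The instance -/

/-- **Weil's functional with unit slack at cutoff `2`, from Platt–Trudgian** (SOS-corrected comb):
`platt_trudgian_numerical_rh → ∀ g ∈ C_c^∞[-2, 2], −‖g‖₂² ≤ Re W(g ⋆ g̃)`. CONDITIONAL on the named hypothesis.
[cite: PlattTrudgianBLMS2021, Theorem 1] -/
theorem unitSlackWeil_two_of_plattTrudgian (hPT : platt_trudgian_numerical_rh) :
    ∀ g : ℝ → ℂ, IsWeilTest g → tsupport g ⊆ Icc (-(2 : ℝ)) 2 →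
      -weilNorm2Sq g ≤ (weilFunctional (weilConv g (weilReflect g))).re := by
  intro g hg hs
  have hRH : RiemannHypothesisInStripUpTo 3000175332800 := platt_trudgian_numerical_rh_iff_inStrip.1 hPT
  -- the density and its bounds
  have hdh : (0 : ℚ) < crKernel2.h := by norm_num [crKernel2]
  have hdL : ((crKernel2.L : ℚ) : ℝ) = 2 * (401 / 200) := by norm_num [crKernel2]
  have hdL0 : (0 : ℚ) ≤ crKernel2.L := by norm_num [crKernel2]
  have hN : Real.exp (2 * (401 / 200)) < (55 : ℕ) + 1 := by
    rw [show (2 : ℝ) * (401 / 200) = 401 / 100 by norm_num]; push_cast; linarith [exp_401_lt]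
  have hT : (0 : ℚ) < crSOS55.T := by norm_num [crSOS55]
  have hLq : 2 * (401 / 200 : ℝ) ≤ ((401 / 100 : ℚ) : ℝ) := by norm_num
  have hexp : Real.exp ((401 / 100 : ℚ) : ℝ) < crSOS55.T := by
    push_cast; rw [show ((crSOS55.T : ℚ) : ℝ) = 111 / 2 by norm_num [crSOS55]]; exact exp_401_lt
  have hF := isSlackDensity_honest hdh hdL hN hT hLq hexp
  set M : ℝ := (4543053/250000) with hM
  have hcomb : ∀ y : ℝ, honestComb 55 y - crSOS55.Hsos y ≤ M := fun y => by
    have h := coef55.honestComb_sub_Hsos_le coef55_check (by decide) crSOS55 crSOS55_checkSOS y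
    exact h.trans sos55_bound_le
  have hC := decayConst_crKernel2_le
  have hLB : ∀ y : ℝ, |y| ≤ (10 : ℝ) ^ 10 →
      -(43723 / 10000 + 4 * 56 + ((4543053/250000) : ℝ)) ≤ honestDensity crKernel2 55 crSOS55 y := by
    intro y _
    have := honestDensity_lowBand hdL0 hdh hcomb y
    norm_num at this ⊢
    linarith
  have hHF : ∀ y : ℝ, (10 : ℝ) ^ 10 < |y| → (1 / 2 : ℝ) ≤ honestDensity crKernel2 55 crSOS55 y := by
    intro y hy
    have h := honestDensity_highFreq hdL0 hdh hcomb (Y₂ := (10 : ℝ) ^ 10) (by norm_num) hy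
    refine le_trans ?_ h
    have hlog : (223 / 10 : ℝ) ≤ Real.log ((10 : ℝ) ^ 10 / 2) := by
      rw [Real.le_log_iff_exp_le (by norm_num)]
      exact exp_223_10_le.trans (by norm_num)
    have hpi := Real.pi_lt_d2
    have hlpi := Real.log_pi_le
    have hE : crKernel2.decayConst / (1 / 4 + ((10 : ℝ) ^ 10) ^ 2) ≤ 56 / (1 / 4 + ((10 : ℝ) ^ 10) ^ 2) :=
      div_le_div_of_nonneg_right hC (by positivity)
    have hpi2 : π / (2 * (10 : ℝ) ^ 10) ≤ 3.15 / (2 * (10 : ℝ) ^ 10) :=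
      div_le_div_of_nonneg_right hpi.le (by positivity)
    norm_num at hE hpi2 ⊢
    linarith
  -- numerical side conditions
  have hcosh : Real.cosh ((3 : ℝ) / 10 ^ 12 / 2) ≤ 10001 / 10000 := by
    refine (cosh_le_one_add_sq (by rw [abs_of_pos (by positivity)]; norm_num)).trans (by norm_num)
  have hpow : (Real.cosh ((3 : ℝ) / 10 ^ 12 / 2) / ((3 : ℝ) / 10 ^ 12)) ^ (4 * (4 + 1)) ≤
      ((10001 / 10000 : ℝ) / ((3 : ℝ) / 10 ^ 12)) ^ (4 * (4 + 1)) :=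
    pow_le_pow_left₀ (by positivity) (div_le_div_of_nonneg_right hcosh (by positivity)) _
  have hτ : 2 * (2 : ℝ) * Real.exp 2 *
      (Real.cosh ((3 : ℝ) / 10 ^ 12 / 2) / ((3 : ℝ) / 10 ^ 12)) ^ (4 * (4 + 1)) /
        (3000175332800 : ℝ) ^ (4 * (4 + 1) - 2) * ((986 / 100) / 3000175332800) ≤ 1 / 10000 := by
    have he := exp_two_le
    have hP : 0 ≤ (Real.cosh ((3 : ℝ) / 10 ^ 12 / 2) / ((3 : ℝ) / 10 ^ 12)) ^ (4 * (4 + 1)) := by positivity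
    calc 2 * (2 : ℝ) * Real.exp 2 *
          (Real.cosh ((3 : ℝ) / 10 ^ 12 / 2) / ((3 : ℝ) / 10 ^ 12)) ^ (4 * (4 + 1)) /
            (3000175332800 : ℝ) ^ (4 * (4 + 1) - 2) * ((986 / 100) / 3000175332800)
        ≤ 2 * (2 : ℝ) * (739 / 100) * ((10001 / 10000 : ℝ) / ((3 : ℝ) / 10 ^ 12)) ^ (4 * (4 + 1)) /
            (3000175332800 : ℝ) ^ (4 * (4 + 1) - 2) * ((986 / 100) / 3000175332800) := by
          gcongr
      _ ≤ 1 / 10000 := by norm_num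
  refine unitSlackWeil_of_rhUpTo hg (b := 2) (by norm_num) hs (h := (3 : ℝ) / 10 ^ 12) (by positivity)
    (m := 4) (b' := 401 / 200) (by norm_num) (H := 3000175332800) (Θ := (986 / 100) / 3000175332800) (by norm_num)
    hRH tailInvImSq_plattTrudgian_le hF (Y₂ := (10 : ℝ) ^ 10) (κ := 1 / 2)
    (B := 43723 / 10000 + 4 * 56 + ((4543053/250000) : ℝ)) (by positivity) (by norm_num) (by norm_num)
    (by norm_num) hHF hLB ?_ ?_
  · norm_num at hτ ⊢; linarith
  · norm_num at hτ ⊢; linarith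

/-- **`SignConeOscillatory` for all cutoffs `a ≤ 2`, conditional on Platt–Trudgian** (body verbatim over Mathlib
primitives; fake weight `c = Λ`, unit slack from `unitSlackWeil_two_of_plattTrudgian`). [cite: PlattTrudgianBLMS2021, Theorem 1] -/
theorem signConeOscillatory_upTo_two_of_plattTrudgian (hPT : platt_trudgian_numerical_rh) :
    ∀ a : ℝ, 0 < a → a ≤ 2 → ∀ (k : ℕ) (g : Fin k → ℝ → ℂ), (∀ i, (ContDiff ℝ ((⊤ : ℕ∞) : WithTop ℕ∞) (g i) ∧ HasCompactSupport (g i)) ∧ tsupport (g i) ⊆ Set.Icc (-a) a) → let F : ℝ → ℂ := fun t => ∑ i, MeasureTheory.convolution (g i) (fun u => (starRingEnd ℂ) ((g i) (-u))) (ContinuousLinearMap.mul ℂ ℂ) MeasureTheory.MeasureSpace.volume t; (∀ n : ℕ, 2 ≤ n → 0 ≤ (F (Real.log n)).re) → (∃ t : ℝ, Real.log 2 ≤ |t| ∧ (F t).re < 0) → let M : ℂ → ℂ := fun s => ∫ u : ℝ, F u * Complex.exp ((s - 1 / 2) * u); -(F 0).re ≤ (M 0 + M 1 + ((1 / (2 *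 Real.pi) : ℂ) * (∫ t : ℝ, M (1 / 2 + t * Complex.I) * ((Complex.digamma (1 / 4 + t / 2 * Complex.I)).re : ℂ)) - F 0 * (Real.log Real.pi : ℂ))).re := by
  refine signConeOscillatory_upTo_of_fakeWeight_unitSlack (b := 2) (c := fun n => Λ n)
    (fun n => ArithmeticFunction.vonMangoldt_nonneg) fun g hg hs => ?_
  have h := unitSlackWeil_two_of_plattTrudgian hPT g hg hs
  unfold weilFunctional weilPrimeTerm at h
  unfold weilNorm2Sq at h
  rw [show weilPolarTerm (weilConv g (weilReflect g)) + weilArchTerm (weilConv g (weilReflect g)) -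
      ∑' n : ℕ, ((Λ n : ℝ) : ℂ) / (Real.sqrt n : ℂ) * (weilConv g (weilReflect g) (Real.log n) +
        weilConv g (weilReflect g) (-Real.log n)) =
      weilPolarTerm (weilConv g (weilReflect g)) - ∑' n : ℕ, ((Λ n : ℝ) : ℂ) / (Real.sqrt n : ℂ) *
        (weilConv g (weilReflect g) (Real.log n) + weilConv g (weilReflect g) (-Real.log n)) +
          weilArchTerm (weilConv g (weilReflect g)) by ring]
  exact h

/-- **`SignConeInequality` for all cutoffs `a ≤ 2`, conditional on Platt–Trudgian** (the route's target body,
restricted to `a ≤ 2`). [cite: PlattTrudgianBLMS2021, Theorem 1] -/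
theorem signConeInequality_upTo_two_of_plattTrudgian (hPT : platt_trudgian_numerical_rh) :
    ∀ a : ℝ, 0 < a → a ≤ 2 → ∀ (k : ℕ) (g : Fin k → ℝ → ℂ), (∀ i, (ContDiff ℝ ((⊤ : ℕ∞) : WithTop ℕ∞) (g i) ∧ HasCompactSupport (g i)) ∧ tsupport (g i) ⊆ Set.Icc (-a) a) → let F : ℝ → ℂ := fun t => ∑ i, MeasureTheory.convolution (g i) (fun u => (starRingEnd ℂ) ((g i) (-u))) (ContinuousLinearMap.mul ℂ ℂ) MeasureTheory.MeasureSpace.volume t; (∀ n : ℕ, 2 ≤ n → 0 ≤ (F (Real.log n)).re) → let M : ℂ → ℂ := fun s => ∫ u : ℝ, F u * Complex.exp ((s - 1 / 2) * u); -(F 0).re ≤ (M 0 + M 1 + ((1 / (2 * Real.pi) : ℂ) * (∫ t : ℝ, M (1 / 2 + t * Complex.I) * ((Complex.digamma (1 / 4 + t / 2 * Complex.I)).re : ℂ)) - F 0 * (Real.log Real.pi : ℂ))).re := by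
  intro a _ha hab k g hg F hn M
  have hW : ∀ g : ℝ → ℂ, IsWeilTest g → tsupport g ⊆ Icc (-(2 : ℝ)) 2 →
      -(∫ t, ‖g t‖ ^ 2) ≤ (weilPolarTerm (weilConv g (weilReflect g)) + weilArchTerm (weilConv g (weilReflect g)) -
        ∑' n : ℕ, (((fun n => Λ n) n : ℝ) : ℂ) / (Real.sqrt n : ℂ) *
          (weilConv g (weilReflect g) (Real.log n) + weilConv g (weilReflect g) (-Real.log n))).re := by
    intro g hg hs
    have h := unitSlackWeil_two_of_plattTrudgian hPT g hg hs
    unfold weilFunctional weilPrimeTerm at h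
    unfold weilNorm2Sq at h
    rw [show weilPolarTerm (weilConv g (weilReflect g)) + weilArchTerm (weilConv g (weilReflect g)) -
        ∑' n : ℕ, (((fun n => Λ n) n : ℝ) : ℂ) / (Real.sqrt n : ℂ) * (weilConv g (weilReflect g) (Real.log n) +
          weilConv g (weilReflect g) (-Real.log n)) =
        weilPolarTerm (weilConv g (weilReflect g)) - ∑' n : ℕ, ((Λ n : ℝ) : ℂ) / (Real.sqrt n : ℂ) *
          (weilConv g (weilReflect g) (Real.log n) + weilConv g (weilReflect g) (-Real.log n)) +
            weilArchTerm (weilConv g (weilReflect g)) by ring]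
    exact h
  exact neg_re_apply_zero_le_re_weilArchPolar_of_fakeWeight_unitSlack (b := 2) (c := fun n => Λ n)
    (fun n => ArithmeticFunction.vonMangoldt_nonneg) hW (g := g) (F := F) rfl (fun i => (hg i).1)
    (fun i => (hg i).2.trans (Icc_subset_Icc (neg_le_neg hab) hab)) hn

end Summit.RiemannHypothesis.RiemannHypothesis.Theorems.SignCone

end
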